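import Mathlib

/-!
# DiscreteObjects / Verify — kernel-checked Hadamard verifier (cell pub-namedobj, seat verify-ref)

Framing: lottery ticket; floor = certified bounds/negative ranges.

A THIRD, kernel-level check for target (H): `isHadamard M` decides `M · Mᵀ = n·I` for an explicit
`List (List Int)` by computation, and `decide` makes the kernel evaluate it. Used on the controls
(Sylvester order 8, Paley I order 12 for q = 11) and intended for any structured hit (Williamson /
Goethals–Seidel first rows are assembled by `williamsonArray`, so a hit of order 668 is certified from
four length-167 rows; full-size `decide` at order 668 is for `native_decide` or the farm).
No mathematical claim beyond the definitions is made here; the controls are the content.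

Gen-2 additions (hadamard seat, proposer): the Goethals–Seidel array `gsArray` (back-circulant `R`),
which is the plug-in actually used by the order-668 families (four circulants over `ZMod 167`), with the
(+) control of the cell's bound line 1 (v = 7, QR-invariant blocks → H(28)); and the two-circulant-core
plug-in `twoCirculantCore` of Fletcher–Gysin–Seberry for a Legendre pair (control LP(7) → H(16)), which is
how an LP(333) hit would be certified as H(668).
-/

namespace Summit.Ventures.DiscreteObjects.Verify

/-- inner product of two integer rows -/
def dot (a b : List Int) : Int := (List.zipWith (· * ·) a b).sum

/-- every entry is ±1 -/
def allPM1 (M : List (List Int)) : Bool := M.all (fun r => r.all (fun x => x = 1 || x = -1))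

/-- `M · Mᵀ = n · I` for an n×n ±1 matrix given as a list of rows -/
def isHadamard (M : List (List Int)) : Bool :=
  let n := M.length
  M.all (fun r => r.length = n) && allPM1 M &&
  (List.range n).all (fun i => (List.range n).all (fun j =>
    dot (M.getD i []) (M.getD j []) = if i = j then (n : Int) else 0))

/-- circulant matrix with first row `r` -/
def circulant (r : List Int) : List (List Int) :=
  let n := r.length
  (List.range n).map (fun i => (List.range n).map (fun j => r.getD ((j + n - i) % n) 0))

/-- entrywise negation of a matrix -/
def negM (A : List (List Int)) : List (List Int) := A.map (fun r => r.map (fun x => -x))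

/-- horizontal concatenation of equally tall blocks -/
def hcat (As : List (List (List Int))) : List (List Int) :=
  match As with
  | [] => []
  | A :: rest => (rest.foldl (fun acc B => List.zipWith (· ++ ·) acc B) A)

/-- Williamson array of four circulants: `[[A,B,C,D],[-B,A,-D,C],[-C,D,A,-B],[-D,-C,B,A]]` -/
def williamsonArray (a b c d : List Int) : List (List Int) :=
  let A := circulant a; let B := circulant b; let C := circulant c; let D := circulant d
  hcat [A, B, C, D] ++ hcat [negM B, A, negM D, C] ++ hcat [negM C, D, A, negM B] ++ hcat [negM D, negM C, B, A]

/-- Sylvester doubling -/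
def sylvester : Nat → List (List Int)
  | 0 => [[1]]
  | k + 1 => let H := sylvester k; (List.zipWith (· ++ ·) H H) ++ (List.zipWith (· ++ ·) H (negM H))

/-- control H+1′: Sylvester order 8 is Hadamard (kernel `decide`) -/
theorem sylvester3_hadamard : isHadamard (sylvester 3) = true := by decide

/-- Paley I matrix of order 12 (q = 11): rows written out explicitly (squares mod 11 = {1,3,4,5,9}) -/
def paley12 : List (List Int) :=
  let chi : Nat → Int := fun a => if a % 11 = 0 then 0 else if a % 11 ∈ [1,3,4,5,9] then 1 else -1
  let Q := (List.range 11).map (fun i => (List.range 11).map (fun j => chi (j + 11 - i)))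
  let S := ([0] ++ List.replicate 11 1) :: (List.range 11).map (fun i => (-1) :: Q.getD i [])
  (List.range 12).map (fun i => (List.range 12).map (fun j => ((S.getD i []).getD j 0) + (if i = j then (1 : Int) else 0)))

/-- control H+2′: Paley I order 12 is Hadamard (kernel `decide`) -/
theorem paley12_hadamard : isHadamard paley12 = true := by decide

/-- control H+3′: Williamson first rows (1,1,1),(1,-1,-1),(1,-1,-1),(1,-1,-1) give a Hadamard matrix of order 12 -/
theorem williamson12_hadamard :
    isHadamard (williamsonArray [1,1,1] [1,-1,-1] [1,-1,-1] [1,-1,-1]) = true := by decide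

/-- control H−2′: flipping one entry of `sylvester 3` breaks it -/
theorem sylvester3_flipped_not_hadamard :
    isHadamard ((sylvester 3).set 2 (((sylvester 3).getD 2 []).set 5 (-(((sylvester 3).getD 2 []).getD 5 0)))) = false := by
  decide

/-- transpose of a square matrix given as a list of rows -/
def transposeM (A : List (List Int)) : List (List Int) :=
  let n := A.length
  (List.range n).map (fun j => (List.range n).map (fun i => (A.getD i []).getD j 0))

/-- product of two square integer matrices given as lists of rows -/
def mulM (A B : List (List Int)) : List (List Int) :=
  let n := A.length
  let Bt := transposeM B
  A.map (fun r => (List.range n).map (fun j => dot r (Bt.getD j [])))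

/-- the back-circulant permutation matrix `R` of order n: `R i j = 1` iff `i + j ≡ 0 (mod n)` -/
def backR (n : Nat) : List (List Int) :=
  (List.range n).map (fun i => (List.range n).map (fun j => if (i + j) % n = 0 then 1 else 0))

/-- Goethals–Seidel array of four circulants `A, B, C, D` (first rows `a, b, c, d`):
`[[A, BR, CR, DR], [-BR, A, DᵀR, -CᵀR], [-CR, -DᵀR, A, BᵀR], [-DR, CᵀR, -BᵀR, A]]`;
it is Hadamard iff `AAᵀ + BBᵀ + CCᵀ + DDᵀ = 4n·I`, i.e. iff the periodic autocorrelations of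
`a, b, c, d` sum to zero at every non-zero shift. -/
def gsArray (a b c d : List Int) : List (List Int) :=
  let n := a.length
  let R := backR n
  let A := circulant a; let B := circulant b; let C := circulant c; let D := circulant d
  let BR := mulM B R; let CR := mulM C R; let DR := mulM D R
  let BtR := mulM (transposeM B) R; let CtR := mulM (transposeM C) R; let DtR := mulM (transposeM D) R
  hcat [A, BR, CR, DR] ++ hcat [negM BR, A, DtR, negM CtR] ++
    hcat [negM CR, negM DtR, A, BtR] ++ hcat [negM DR, CtR, negM BtR, A]

/-- control for bound line 1 of the census (family "GS over ℤ_v with QR-invariant circulant blocks"),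
(+) side at v = 7: blocks constant on {0}, QR = {1,2,4}, NQR = {3,5,6}; the quadruple of first rows
`(+,+,+,-,+,-,-)` ×3 and `(+,-,-,-,-,-,-)` (block PAFs −1, −1, −1, 3 at every shift) gives H(28). -/
theorem gs28_qr_hadamard :
    isHadamard (gsArray [1,1,1,-1,1,-1,-1] [1,1,1,-1,1,-1,-1] [1,1,1,-1,1,-1,-1] [1,-1,-1,-1,-1,-1,-1]) = true := by
  decide

/-- control: the GS array detects a non-solution (v = 7, four equal QR blocks: PAF sum −4 ≠ 0) -/
theorem gs28_qr_not_hadamard :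
    isHadamard (gsArray [1,1,1,-1,1,-1,-1] [1,1,1,-1,1,-1,-1] [1,1,1,-1,1,-1,-1] [1,1,1,-1,1,-1,-1]) = false := by
  decide

/-- two-circulant-core array of Fletcher–Gysin–Seberry for a pair `(a, b)` of ±1 sequences of odd
length ℓ with row sums +1: order 2ℓ + 2,
`[[-1, -1, e, e], [-1, 1, e, -e], [eᵀ, eᵀ, A, B], [eᵀ, -eᵀ, Bᵀ, -Aᵀ]]` (e = all-ones row);
it is Hadamard iff `(a, b)` is a Legendre pair (PAF_a + PAF_b = −2 off zero). An LP(333) would be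
certified as H(668) by `isHadamard (twoCirculantCore a b)`. -/
def twoCirculantCore (a b : List Int) : List (List Int) :=
  let l := a.length
  let A := circulant a; let B := circulant b
  let e : List Int := List.replicate l 1
  let ne : List Int := List.replicate l (-1)
  let top1 : List Int := [-1, -1] ++ e ++ e
  let top2 : List Int := [-1, 1] ++ e ++ ne
  let mid := (List.range l).map (fun i => [1, 1] ++ A.getD i [] ++ B.getD i [])
  let bot := (List.range l).map (fun i => [1, -1] ++ (transposeM B).getD i [] ++ (negM (transposeM A)).getD i [])
  [top1, top2] ++ mid ++ bot

/-- control for the Legendre-pair family: the Legendre pair of length 7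
`a = b = (+,+,+,-,+,-,-)` (quadratic residues mod 7, a₀ = +1) gives H(16). -/
theorem lp7_core_hadamard :
    isHadamard (twoCirculantCore [1,1,1,-1,1,-1,-1] [1,1,1,-1,1,-1,-1]) = true := by
  decide

/-- control: a non-Legendre pair of length 7 is rejected by the same plug-in -/
theorem nonlp7_core_not_hadamard :
    isHadamard (twoCirculantCore [1,1,1,-1,1,-1,-1] [1,1,1,1,-1,-1,-1]) = false := by
  decide

end Summit.Ventures.DiscreteObjects.Verify
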